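import Mathlib
import HarnessLib
import Summits.Ventures.LatticeQCDFlow.Scoring.RegenerativeMedianOfGroupsSigma
import Summits.Ventures.LatticeQCDFlow.Scoring.RestartTimeAverage

/-!
# Non-equilibrium evolutions restarted from a prior chain: a Doeblin constant `ε₀` of the PRIOR sweep
# gives the restart chain regeneration tours at rate `ε₀`, the tour estimator's error bar at the CLT
# scale `4(ε₀ σ²_G/s² + 1 − ε₀)/R`, the median-of-groups bound `e^{−K/8}`, and `0 ≤ σ²_G ≤ (2C)²(2−ε₀)/ε₀`

HONEST FRAMING: exact (Metropolis-corrected) sampling algorithms for lattice gauge theory;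
figures of merit are autocorrelation/cost numbers at stated couplings and volumes; no
continuum-physics claim.

Venture `LatticeQCDFlow` (cell pub-lqcd), topic `Scoring`; FANOUT row 8 (`s0-cpn-nemc`, GEN-17 —
the row's own protocol: Bonanno–Nada–Vadacchino's non-equilibrium evolutions are started every
`n_between` sweeps of an EQUILIBRIUM PRIOR CHAIN; BNV 2024 NAMED ONLY).  NEW WORK of the cell, not a
published result; no definition is introduced.  The restart chain of `Scoring/RestartChainAutocorrelation.lean`
moves `(x, ω) ↦ (x', ω')`, `x' ∼ κ₀(x, ·)` (prior sweep), `ω' ∼ κF(x', ·)` (a fresh forward evolution /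
record); its invariant law is `Π = π₀ ⊗ₘ κF` and a Doeblin constant `ε₀` of the prior chain by `π₀` is
one of the restart chain by `Π` (`Scoring/RestartTimeAverage.restart_doeblin`).  Hence every split
kernel of `(K, Π, ε₀)` carries regeneration tours, and GEN-17's chapter applies verbatim to every
bounded measurable RECORD observable `G` (a truncated Jarzynski weight `e^{−W}`, an end-point
observable, an indicator): the asymptotic variance `σ²_G = Var_Π G + 2 Σ_{k≥1} C_G(k)` of `G` along the
correlated-restart chain satisfies `0 ≤ σ²_G ≤ (2C)²(2 − ε₀)/ε₀`; the tour estimator of `Π(G)` obeys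
`P(s ≤ |Â_R − Π(G)|) ≤ 4(ε₀ σ²_G/s² + (1 − ε₀))/R` from ANY start; and the median of `K` tour-group
estimates is off by `≥ s` with probability `≤ e^{−K/8}` once `4(ε₀ σ²_G/s² + 1 − ε₀)/m ≤ 1/4`.  Read
with `Scoring/RestartChainAutocorrelation.lean`: `σ²_G = Var_Π G + 2 Σ_{k≥1} C^{κ₀}_h(k)` with
`h = E[G | start]`, so the certificate is driven by the prior sweep's autocorrelation of the
CONDITIONAL MEAN of the weight.  Printed counterpart NAMED ONLY: regenerative simulation
(Mykland–Tierney–Yu 1995); nothing on NE-MCMC error bars is cited as a fact.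

## Content (`κ₀` Markov on `Ω` with invariant `π₀` and `κ₀(x, ·) ≥ ε₀ π₀`, `0 < ε₀ < 1`; `κF` Markov
## `Ω → E`; `K = prodMkRight E κ₀ ⊗ₖ prodMkLeft (Ω × E) κF`, `Π = π₀ ⊗ₘ κF`; `|G| ≤ C` measurable;
## `κ̂` any split kernel of `(K, Π, ε₀)`; tours `1..R` from any start; `e = ε₀.toReal`)

* **`restart_asymptoticVariance_bounds`** — `0 ≤ σ²_G ≤ (2C)²(2 − e)/e`;
* **`restart_asymptoticVariance_eq`** — THE RESTART LAW `σ²_G(K) = Var_Π G + 2 Σ_{k≥1} C^{κ₀}_h(k)`;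
* **`restart_regenerative_confidence_sigma`** — `P(s ≤ |Â_R − Π(G)|) ≤ 4(e σ²_G/s² + (1 − e))/R`;
* **`restart_regenerative_medianOfGroups_sigma`** — the `e^{−K/8}` median-of-groups bound.

NOT CLAIMED: any `ε₀` of a concrete sweep; observability of the coins for the restart chain (the
prior sweep's minorisation is abstract); unbounded weights; the ratio (self-normalised) estimator.
-/

noncomputable section

namespace Summit.Ventures.LatticeQCDFlow.Scoring

open MeasureTheory ProbabilityTheory Filter Finset Preorder
open Literature.Probability.MarkovChains
open scoped ENNReal

variable {Ω E : Type*} [MeasurableSpace Ω] [MeasurableSpace E]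

section Restart

variable {κ₀ : Kernel Ω Ω} [IsMarkovKernel κ₀] {κF : Kernel Ω E} [IsMarkovKernel κF]
  {π₀ : Measure Ω} [IsProbabilityMeasure π₀] {ε : ℝ≥0∞}

/-- **Asymptotic variance of a record observable along the restart chain**: with a Doeblin constant
`0 < ε₀ < 1` of the prior chain, `0 ≤ σ²_G ≤ (2C)²(2 − e)/e` for every bounded measurable `G`. -/
theorem restart_asymptoticVariance_bounds (hπ₀ : Kernel.Invariant κ₀ π₀)
    (hmin : ∀ x {B : Set Ω}, MeasurableSet B → ε * π₀ B ≤ κ₀ x B) (hε0 : 0 < ε) (hε : ε < 1)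
    {G : Ω × E → ℝ} (hG : Measurable G) {C : ℝ} (hC : ∀ p, |G p| ≤ C) :
    0 ≤ (∫ p, (G p - ∫ p', G p' ∂(π₀ ⊗ₘ κF)) ^ 2 ∂(π₀ ⊗ₘ κF))
        + 2 * ∑' k, ∫ p, (G p - ∫ p', G p' ∂(π₀ ⊗ₘ κF))
          * (kop ((Kernel.prodMkRight E κ₀) ⊗ₖ (Kernel.prodMkLeft (Ω × E) κF)))^[k + 1]
            (fun p => G p - ∫ p', G p' ∂(π₀ ⊗ₘ κF)) p ∂(π₀ ⊗ₘ κF)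
    ∧ (∫ p, (G p - ∫ p', G p' ∂(π₀ ⊗ₘ κF)) ^ 2 ∂(π₀ ⊗ₘ κF))
        + 2 * ∑' k, ∫ p, (G p - ∫ p', G p' ∂(π₀ ⊗ₘ κF))
          * (kop ((Kernel.prodMkRight E κ₀) ⊗ₖ (Kernel.prodMkLeft (Ω × E) κF)))^[k + 1]
            (fun p => G p - ∫ p', G p' ∂(π₀ ⊗ₘ κF)) p ∂(π₀ ⊗ₘ κF)
      ≤ (2 * C) ^ 2 * (2 - ε.toReal) / ε.toReal :=
  ⟨asymptoticVariance_nonneg_minorised (invariant_restart hπ₀)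
      (fun p _ hS => restart_doeblin (κF := κF) hmin p hS) hε0 hε hG hC,
    asymptoticVariance_le_minorised (invariant_restart hπ₀)
      (fun p _ hS => restart_doeblin (κF := κF) hmin p hS) hε0 hε hG hC⟩

/-- **THE RESTART LAW FOR THE ASYMPTOTIC VARIANCE**: for every bounded measurable record observable
`G`, with `h(x) = ∫ G(x, ω) κF(x, dω)` its conditional mean given the start and `c = Π(G)`:
`Var_Π G + 2 Σ_{k≥1} C^K_G(k) = Var_Π G + 2 Σ_{k≥1} C^{κ₀}_{h}(k)` — the lag-`≥ 1` part of the
correlated-restart chain's asymptotic variance IS the prior chain's, evaluated on the conditional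
mean of the weight (so `σ²_G(K) = E Var(G | start) + σ²_h(κ₀)`). -/
theorem restart_asymptoticVariance_eq {G : Ω × E → ℝ} (hG : Measurable G) {C : ℝ}
    (hC : ∀ p, |G p| ≤ C) :
    (∫ p, (G p - ∫ p', G p' ∂(π₀ ⊗ₘ κF)) ^ 2 ∂(π₀ ⊗ₘ κF))
        + 2 * ∑' k, ∫ p, (G p - ∫ p', G p' ∂(π₀ ⊗ₘ κF))
          * (kop ((Kernel.prodMkRight E κ₀) ⊗ₖ (Kernel.prodMkLeft (Ω × E) κF)))^[k + 1]
            (fun p => G p - ∫ p', G p' ∂(π₀ ⊗ₘ κF)) p ∂(π₀ ⊗ₘ κF)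
      = (∫ p, (G p - ∫ p', G p' ∂(π₀ ⊗ₘ κF)) ^ 2 ∂(π₀ ⊗ₘ κF))
        + 2 * ∑' k, ∫ x, ((∫ ω, G (x, ω) ∂(κF x)) - ∫ p', G p' ∂(π₀ ⊗ₘ κF))
          * (kop κ₀)^[k + 1] (fun x => (∫ ω, G (x, ω) ∂(κF x)) - ∫ p', G p' ∂(π₀ ⊗ₘ κF)) x ∂π₀ := by
  set c := ∫ p', G p' ∂(π₀ ⊗ₘ κF) with hc
  have hGc : Measurable fun p => G p - c := hG.sub_const c
  have hcC : |c| ≤ C := by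
    calc |c| = ‖∫ p', G p' ∂(π₀ ⊗ₘ κF)‖ := (Real.norm_eq_abs _).symm
      _ ≤ C * (π₀ ⊗ₘ κF).real Set.univ := norm_integral_le_of_norm_le_const
          (Eventually.of_forall fun p => by rw [Real.norm_eq_abs]; exact hC p)
      _ = C := by rw [probReal_univ, mul_one]
  have hGcC : ∀ p, |G p - c| ≤ C + C := fun p => (abs_sub _ _).trans (add_le_add (hC p) hcC)
  -- the conditional mean of `G − c` is `h − c`
  have hcond : (fun x => ∫ ω, (G (x, ω) - c) ∂(κF x)) = fun x => (∫ ω, G (x, ω) ∂(κF x)) - c := by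
    funext x
    have hGx : Measurable fun ω => G (x, ω) := hG.comp measurable_prodMk_left
    rw [integral_sub (integrable_of_bounded (κF x) hGx fun ω => hC (x, ω))
      (integrable_const c), integral_const, probReal_univ, one_smul]
  congr 1
  congr 1
  refine tsum_congr fun k => ?_
  have h := autocov_restart_succ (κ₀ := κ₀) (κF := κF) (π₀ := π₀) hGc hGcC k
  unfold autocov at h
  rw [hcond] at h
  exact h

variable (κs : Kernel ((Ω × E) × Bool) ((Ω × E) × Bool)) [IsMarkovKernel κs]
  (μs : Measure ((Ω × E) × Bool)) [IsProbabilityMeasure μs]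

/-- **The tour estimator of a record observable along the restart chain, AT THE CLT SCALE**: for
every split kernel `κ̂` of `(K, Π, ε₀)` and every initial law,
`P(s ≤ |Â_R − Π(G)|) ≤ 4 (e σ²_G/s² + (1 − e)) / R`. -/
theorem restart_regenerative_confidence_sigma (hπ₀ : Kernel.Invariant κ₀ π₀)
    (hmin : ∀ x {B : Set Ω}, MeasurableSet B → ε * π₀ B ≤ κ₀ x B) (hε0 : 0 < ε) (hε : ε < 1)
    (hκs : ∀ p, κs p = (ε • (π₀ ⊗ₘ κF)).map (fun y : Ω × E => (y, true))
      + ((1 - ε) • Doeblin.residualKernel ((Kernel.prodMkRight E κ₀) ⊗ₖ (Kernel.prodMkLeft (Ω × E) κF))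
          (π₀ ⊗ₘ κF) ε (fun p _ hS => restart_doeblin (κF := κF) hmin p hS) p.1).map
        (fun y : Ω × E => (y, false)))
    {G : Ω × E → ℝ} (hG : Measurable G) {C : ℝ} (hC : ∀ p, |G p| ≤ C) {R : ℕ} (hR : 0 < R)
    {s : ℝ} (hs : 0 < s) :
    (Kernel.trajMeasure (X := fun _ : ℕ => (Ω × E) × Bool) μs
        (fun n : ℕ => κs.comap (fun h : (i : ↥(Finset.Iic n)) → (Ω × E) × Bool =>
          h ⟨n, Finset.mem_Iic.2 le_rfl⟩) (measurable_pi_apply _))).real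
      {x | s ≤ |(∑ i ∈ Finset.range R, ∑' u, (if (∑ s ∈ Finset.range u,
            (if (x (s + 1)).2 then (1 : ℕ) else 0)) = i + 1 then (1 : ℝ) else 0) * G (x u).1)
          / (∑ i ∈ Finset.range R, ∑' u, (if (∑ s ∈ Finset.range u,
            (if (x (s + 1)).2 then (1 : ℕ) else 0)) = i + 1 then (1 : ℝ) else 0))
          - ∫ p, G p ∂(π₀ ⊗ₘ κF)|}
      ≤ 4 * (ε.toReal * ((∫ p, (G p - ∫ p', G p' ∂(π₀ ⊗ₘ κF)) ^ 2 ∂(π₀ ⊗ₘ κF))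
          + 2 * ∑' k, ∫ p, (G p - ∫ p', G p' ∂(π₀ ⊗ₘ κF))
            * (kop ((Kernel.prodMkRight E κ₀) ⊗ₖ (Kernel.prodMkLeft (Ω × E) κF)))^[k + 1]
              (fun p => G p - ∫ p', G p' ∂(π₀ ⊗ₘ κF)) p ∂(π₀ ⊗ₘ κF))
          / s ^ 2 + (1 - ε.toReal)) / R :=
  regenerative_estimator_confidence_sigma κs μs
    (κ := (Kernel.prodMkRight E κ₀) ⊗ₖ (Kernel.prodMkLeft (Ω × E) κF)) (ν := π₀ ⊗ₘ κF)
    (hmin := fun p _ hS => restart_doeblin (κF := κF) hmin p hS) (invariant_restart hπ₀) hε0 hε hκs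
    hG hC hR hs

/-- **Median of tour groups for the restart chain at the CLT scale**: if
`4(e σ²_G/s² + (1 − e))/m ≤ 1/4` then `P(#{bad groups among K} ≥ K/2) ≤ e^{−K/8}`, any start. -/
theorem restart_regenerative_medianOfGroups_sigma (hπ₀ : Kernel.Invariant κ₀ π₀)
    (hmin : ∀ x {B : Set Ω}, MeasurableSet B → ε * π₀ B ≤ κ₀ x B) (hε0 : 0 < ε) (hε : ε < 1)
    (hκs : ∀ p, κs p = (ε • (π₀ ⊗ₘ κF)).map (fun y : Ω × E => (y, true))
      + ((1 - ε) • Doeblin.residualKernel ((Kernel.prodMkRight E κ₀) ⊗ₖ (Kernel.prodMkLeft (Ω × E) κF))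
          (π₀ ⊗ₘ κF) ε (fun p _ hS => restart_doeblin (κF := κF) hmin p hS) p.1).map
        (fun y : Ω × E => (y, false)))
    {G : Ω × E → ℝ} (hG : Measurable G) {C : ℝ} (hC : ∀ p, |G p| ≤ C) {m : ℕ} (hm : 0 < m)
    {s : ℝ} (hs : 0 < s)
    (hq : 4 * (ε.toReal * ((∫ p, (G p - ∫ p', G p' ∂(π₀ ⊗ₘ κF)) ^ 2 ∂(π₀ ⊗ₘ κF))
          + 2 * ∑' k, ∫ p, (G p - ∫ p', G p' ∂(π₀ ⊗ₘ κF))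
            * (kop ((Kernel.prodMkRight E κ₀) ⊗ₖ (Kernel.prodMkLeft (Ω × E) κF)))^[k + 1]
              (fun p => G p - ∫ p', G p' ∂(π₀ ⊗ₘ κF)) p ∂(π₀ ⊗ₘ κF))
          / s ^ 2 + (1 - ε.toReal)) / m ≤ 1 / 4) (K : ℕ) :
    (Kernel.trajMeasure (X := fun _ : ℕ => (Ω × E) × Bool) μs
        (fun n : ℕ => κs.comap (fun h : (i : ↥(Finset.Iic n)) → (Ω × E) × Bool =>
          h ⟨n, Finset.mem_Iic.2 le_rfl⟩) (measurable_pi_apply _))).real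
      {x | (K : ℝ) / 2 ≤ ∑ k ∈ Finset.range K,
        (if s ≤ |(∑ i ∈ Finset.range m, ∑' u, (if (∑ s ∈ Finset.range u,
              (if (x (s + 1)).2 then (1 : ℕ) else 0)) = k * (m + 1) + i + 1 then (1 : ℝ) else 0)
              * G (x u).1)
            / (∑ i ∈ Finset.range m, ∑' u, (if (∑ s ∈ Finset.range u,
              (if (x (s + 1)).2 then (1 : ℕ) else 0)) = k * (m + 1) + i + 1 then (1 : ℝ) else 0))
            - ∫ p, G p ∂(π₀ ⊗ₘ κF)| then (1 : ℝ) else 0)}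
      ≤ Real.exp (-((K : ℝ) / 8)) :=
  regenerative_medianOfGroups_confidence_sigma κs μs
    (κ := (Kernel.prodMkRight E κ₀) ⊗ₖ (Kernel.prodMkLeft (Ω × E) κF)) (ν := π₀ ⊗ₘ κF)
    (hmin := fun p _ hS => restart_doeblin (κF := κF) hmin p hS) (invariant_restart hπ₀) hε0 hε hκs
    hG hC hm hs hq K

end Restart

end Summit.Ventures.LatticeQCDFlow.Scoring

end
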